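import Summits.BirchSwinnertonDyer.BirchSwinnertonDyer.Theorems.Rank2ObservatoryRank2Table
import Summits.BirchSwinnertonDyer.BirchSwinnertonDyer.Theorems.Rank2ObservatoryRank2Rows30a
import Summits.BirchSwinnertonDyer.BirchSwinnertonDyer.Theorems.Rank2ObservatoryRank2Rows30b
import Summits.BirchSwinnertonDyer.BirchSwinnertonDyer.Theorems.Rank2ObservatoryRank2Rows31a
import Summits.BirchSwinnertonDyer.BirchSwinnertonDyer.Theorems.Rank2ObservatoryRank2Rows31b
import Summits.BirchSwinnertonDyer.BirchSwinnertonDyer.Theorems.Rank2ObservatoryRank2Rows32a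
import Summits.BirchSwinnertonDyer.BirchSwinnertonDyer.Theorems.Rank2ObservatoryRank2Rows32b
import Summits.BirchSwinnertonDyer.BirchSwinnertonDyer.Theorems.Rank2ObservatoryRank2Rows33a
import Summits.BirchSwinnertonDyer.BirchSwinnertonDyer.Theorems.Rank2ObservatoryRank2Rows33b
import Summits.BirchSwinnertonDyer.BirchSwinnertonDyer.Theorems.Rank2ObservatoryRank2Rows34a
import Summits.BirchSwinnertonDyer.BirchSwinnertonDyer.Theorems.Rank2ObservatoryRank2Rows34b
import Summits.BirchSwinnertonDyer.BirchSwinnertonDyer.Theorems.Rank2ObservatoryRank2Rows35a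
import Summits.BirchSwinnertonDyer.BirchSwinnertonDyer.Theorems.Rank2ObservatoryRank2Rows35b
import Summits.BirchSwinnertonDyer.BirchSwinnertonDyer.Theorems.Rank2ObservatoryRank2Rows36a
import Summits.BirchSwinnertonDyer.BirchSwinnertonDyer.Theorems.Rank2ObservatoryRank2Rows36b
import Summits.BirchSwinnertonDyer.BirchSwinnertonDyer.Theorems.Rank2ObservatoryRank2Rows37a
import Summits.BirchSwinnertonDyer.BirchSwinnertonDyer.Theorems.Rank2ObservatoryRank2Rows37b
import Summits.BirchSwinnertonDyer.BirchSwinnertonDyer.Theorems.Rank2ObservatoryRank2Rows38a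
import Summits.BirchSwinnertonDyer.BirchSwinnertonDyer.Theorems.Rank2ObservatoryRank2Rows38b
import Summits.BirchSwinnertonDyer.BirchSwinnertonDyer.Theorems.Rank2ObservatoryRank2Rows39a
import Summits.BirchSwinnertonDyer.BirchSwinnertonDyer.Theorems.Rank2ObservatoryRank2Rows39b
import HarnessLib

/-!
# BirchSwinnertonDyer — rank ≥ 2 observatory: rank-2 census table, decade 3 of 10 (`150000 ≤ N < 200000`)

HONEST FRAMING: per-curve certified theorems and census instruments; no claim on BSD in rank ≥ 2.

Machine-written AGGREGATION level of the rank-2 census (schema `Rank2ObservatoryRank2Table.lean`, data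
chunks `Rank2ObservatoryRank2Rows30a … 39b`, census `Rank2ObservatoryRank2Census.lean`): `rank2Decade3` is the
concatenation of the 20 chunks of conductor windows 30–39 (`150000 ≤ N < 200000`; a window above the gate's
200 kB file cap is stored as two half-window chunks `NNa`, `NNb`) — rows 91550–126843 of `rank2_table.tsv`
(sha256 `8b151c933b69ee8dae4834c21efd171353ae94c887716c05b7381d12d173f912`), 35294 curves from `150015c1` to
`199998k1`. Its theorems are assembled from the chunk theorems (each a kernel `decide`) by
`List.all_append` / `List.length_append` rewriting only; no row is re-evaluated here. The two-level
assembly (chunks → decades → table) keeps every file under the tree's 400-line limit and every list short.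

Reference: J. E. Cremona, *Algorithms for Modular Elliptic Curves* (2nd ed. 1997), tables / ecdata.
-/

-- single-conjunct summit: `Summit.BirchSwinnertonDyer.BirchSwinnertonDyer.…` repeats the name by design
set_option linter.dupNamespace false

namespace Summit.BirchSwinnertonDyer.BirchSwinnertonDyer.Rank2Observatory

/-- The 20 chunks of decade 3 (conductors `150000 ≤ N < 200000`), in order. [cite: CremonaAlgorithms1997, Tables] -/
noncomputable def rank2Decade3Chunks : List (List Rank2Row) := [
  rank2Rows30a, rank2Rows30b, rank2Rows31a, rank2Rows31b, rank2Rows32a, rank2Rows32b,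
  rank2Rows33a, rank2Rows33b, rank2Rows34a, rank2Rows34b, rank2Rows35a, rank2Rows35b,
  rank2Rows36a, rank2Rows36b, rank2Rows37a, rank2Rows37b, rank2Rows38a, rank2Rows38b,
  rank2Rows39a, rank2Rows39b]

/-- Decade 3 of the rank-2 census table: the 35294 rank-2 curves of conductor `150000 ≤ N < 200000` (rows 91550–126843).
[cite: CremonaAlgorithms1997, Tables] -/
noncomputable def rank2Decade3 : List Rank2Row :=
  rank2Decade3Chunks.flatten

/-- Every row of decade 3 satisfies `Rank2Row.check` (from the 20 chunk theorems). [folklore] -/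
theorem rank2Decade3_check : rank2Decade3.all Rank2Row.check = true := by
  simp only [rank2Decade3, rank2Decade3Chunks, List.flatten_cons, List.flatten_nil, List.all_append, List.all_nil,
    Bool.and_true,
    rank2Rows30a_check, rank2Rows30b_check, rank2Rows31a_check, rank2Rows31b_check,
    rank2Rows32a_check, rank2Rows32b_check, rank2Rows33a_check, rank2Rows33b_check,
    rank2Rows34a_check, rank2Rows34b_check, rank2Rows35a_check, rank2Rows35b_check,
    rank2Rows36a_check, rank2Rows36b_check, rank2Rows37a_check, rank2Rows37b_check,
    rank2Rows38a_check, rank2Rows38b_check, rank2Rows39a_check, rank2Rows39b_check]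

/-- Decade 3 has `35294` rows (sum of the 20 kernel-counted chunk lengths). [cite: CremonaAlgorithms1997, Tables] -/
theorem rank2Decade3_length : rank2Decade3.length = 35294 := by
  simp only [rank2Decade3, rank2Decade3Chunks, List.flatten_cons, List.flatten_nil, List.length_append, List.length_nil,
    rank2Rows30a_length, rank2Rows30b_length, rank2Rows31a_length, rank2Rows31b_length,
    rank2Rows32a_length, rank2Rows32b_length, rank2Rows33a_length, rank2Rows33b_length,
    rank2Rows34a_length, rank2Rows34b_length, rank2Rows35a_length, rank2Rows35b_length,
    rank2Rows36a_length, rank2Rows36b_length, rank2Rows37a_length, rank2Rows37b_length,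
    rank2Rows38a_length, rank2Rows38b_length, rank2Rows39a_length, rank2Rows39b_length]

/-- Every conductor of decade 3 is `< 500 000` (from the 20 kernel-checked chunk ranges).
[cite: CremonaAlgorithms1997, Tables] -/
theorem rank2Decade3_conductor_lt : rank2Decade3.all (fun r => decide (r.N < 500000)) = true := by
  simp only [rank2Decade3, rank2Decade3Chunks, List.flatten_cons, List.flatten_nil, List.all_append, List.all_nil,
    Bool.and_true,
    Rank2Row.all_conductorLt_of_all_range (by norm_num) rank2Rows30a_conductor,
    Rank2Row.all_conductorLt_of_all_range (by norm_num) rank2Rows30b_conductor,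
    Rank2Row.all_conductorLt_of_all_range (by norm_num) rank2Rows31a_conductor,
    Rank2Row.all_conductorLt_of_all_range (by norm_num) rank2Rows31b_conductor,
    Rank2Row.all_conductorLt_of_all_range (by norm_num) rank2Rows32a_conductor,
    Rank2Row.all_conductorLt_of_all_range (by norm_num) rank2Rows32b_conductor,
    Rank2Row.all_conductorLt_of_all_range (by norm_num) rank2Rows33a_conductor,
    Rank2Row.all_conductorLt_of_all_range (by norm_num) rank2Rows33b_conductor,
    Rank2Row.all_conductorLt_of_all_range (by norm_num) rank2Rows34a_conductor,
    Rank2Row.all_conductorLt_of_all_range (by norm_num) rank2Rows34b_conductor,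
    Rank2Row.all_conductorLt_of_all_range (by norm_num) rank2Rows35a_conductor,
    Rank2Row.all_conductorLt_of_all_range (by norm_num) rank2Rows35b_conductor,
    Rank2Row.all_conductorLt_of_all_range (by norm_num) rank2Rows36a_conductor,
    Rank2Row.all_conductorLt_of_all_range (by norm_num) rank2Rows36b_conductor,
    Rank2Row.all_conductorLt_of_all_range (by norm_num) rank2Rows37a_conductor,
    Rank2Row.all_conductorLt_of_all_range (by norm_num) rank2Rows37b_conductor,
    Rank2Row.all_conductorLt_of_all_range (by norm_num) rank2Rows38a_conductor,
    Rank2Row.all_conductorLt_of_all_range (by norm_num) rank2Rows38b_conductor,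
    Rank2Row.all_conductorLt_of_all_range (by norm_num) rank2Rows39a_conductor,
    Rank2Row.all_conductorLt_of_all_range (by norm_num) rank2Rows39b_conductor]

/-- A row of a chunk of decade 3 is a row of the decade. [folklore] -/
theorem mem_rank2Decade3_of_mem_chunk {l : List Rank2Row} (hl : l ∈ rank2Decade3Chunks) {r : Rank2Row} (hr : r ∈ l) :
    r ∈ rank2Decade3 :=
  List.mem_flatten.mpr ⟨l, hl, hr⟩

/-- Chunk 30a is a chunk of decade 3. [folklore] -/
theorem rank2Rows30a_mem_decade3 : rank2Rows30a ∈ rank2Decade3Chunks :=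
  List.mem_iff_getElem?.mpr ⟨0, rfl⟩

/-- Chunk 30b is a chunk of decade 3. [folklore] -/
theorem rank2Rows30b_mem_decade3 : rank2Rows30b ∈ rank2Decade3Chunks :=
  List.mem_iff_getElem?.mpr ⟨1, rfl⟩

/-- Chunk 31a is a chunk of decade 3. [folklore] -/
theorem rank2Rows31a_mem_decade3 : rank2Rows31a ∈ rank2Decade3Chunks :=
  List.mem_iff_getElem?.mpr ⟨2, rfl⟩

/-- Chunk 31b is a chunk of decade 3. [folklore] -/
theorem rank2Rows31b_mem_decade3 : rank2Rows31b ∈ rank2Decade3Chunks :=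
  List.mem_iff_getElem?.mpr ⟨3, rfl⟩

/-- Chunk 32a is a chunk of decade 3. [folklore] -/
theorem rank2Rows32a_mem_decade3 : rank2Rows32a ∈ rank2Decade3Chunks :=
  List.mem_iff_getElem?.mpr ⟨4, rfl⟩

/-- Chunk 32b is a chunk of decade 3. [folklore] -/
theorem rank2Rows32b_mem_decade3 : rank2Rows32b ∈ rank2Decade3Chunks :=
  List.mem_iff_getElem?.mpr ⟨5, rfl⟩

/-- Chunk 33a is a chunk of decade 3. [folklore] -/
theorem rank2Rows33a_mem_decade3 : rank2Rows33a ∈ rank2Decade3Chunks :=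
  List.mem_iff_getElem?.mpr ⟨6, rfl⟩

/-- Chunk 33b is a chunk of decade 3. [folklore] -/
theorem rank2Rows33b_mem_decade3 : rank2Rows33b ∈ rank2Decade3Chunks :=
  List.mem_iff_getElem?.mpr ⟨7, rfl⟩

/-- Chunk 34a is a chunk of decade 3. [folklore] -/
theorem rank2Rows34a_mem_decade3 : rank2Rows34a ∈ rank2Decade3Chunks :=
  List.mem_iff_getElem?.mpr ⟨8, rfl⟩

/-- Chunk 34b is a chunk of decade 3. [folklore] -/
theorem rank2Rows34b_mem_decade3 : rank2Rows34b ∈ rank2Decade3Chunks :=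
  List.mem_iff_getElem?.mpr ⟨9, rfl⟩

/-- Chunk 35a is a chunk of decade 3. [folklore] -/
theorem rank2Rows35a_mem_decade3 : rank2Rows35a ∈ rank2Decade3Chunks :=
  List.mem_iff_getElem?.mpr ⟨10, rfl⟩

/-- Chunk 35b is a chunk of decade 3. [folklore] -/
theorem rank2Rows35b_mem_decade3 : rank2Rows35b ∈ rank2Decade3Chunks :=
  List.mem_iff_getElem?.mpr ⟨11, rfl⟩

/-- Chunk 36a is a chunk of decade 3. [folklore] -/
theorem rank2Rows36a_mem_decade3 : rank2Rows36a ∈ rank2Decade3Chunks :=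
  List.mem_iff_getElem?.mpr ⟨12, rfl⟩

/-- Chunk 36b is a chunk of decade 3. [folklore] -/
theorem rank2Rows36b_mem_decade3 : rank2Rows36b ∈ rank2Decade3Chunks :=
  List.mem_iff_getElem?.mpr ⟨13, rfl⟩

/-- Chunk 37a is a chunk of decade 3. [folklore] -/
theorem rank2Rows37a_mem_decade3 : rank2Rows37a ∈ rank2Decade3Chunks :=
  List.mem_iff_getElem?.mpr ⟨14, rfl⟩

/-- Chunk 37b is a chunk of decade 3. [folklore] -/
theorem rank2Rows37b_mem_decade3 : rank2Rows37b ∈ rank2Decade3Chunks :=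
  List.mem_iff_getElem?.mpr ⟨15, rfl⟩

/-- Chunk 38a is a chunk of decade 3. [folklore] -/
theorem rank2Rows38a_mem_decade3 : rank2Rows38a ∈ rank2Decade3Chunks :=
  List.mem_iff_getElem?.mpr ⟨16, rfl⟩

/-- Chunk 38b is a chunk of decade 3. [folklore] -/
theorem rank2Rows38b_mem_decade3 : rank2Rows38b ∈ rank2Decade3Chunks :=
  List.mem_iff_getElem?.mpr ⟨17, rfl⟩

/-- Chunk 39a is a chunk of decade 3. [folklore] -/
theorem rank2Rows39a_mem_decade3 : rank2Rows39a ∈ rank2Decade3Chunks :=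
  List.mem_iff_getElem?.mpr ⟨18, rfl⟩

/-- Chunk 39b is a chunk of decade 3. [folklore] -/
theorem rank2Rows39b_mem_decade3 : rank2Rows39b ∈ rank2Decade3Chunks :=
  List.mem_iff_getElem?.mpr ⟨19, rfl⟩

end Summit.BirchSwinnertonDyer.BirchSwinnertonDyer.Rank2Observatory
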